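import Literature.Analysis.FluidPDE.MixedNormSliceBounds
import HarnessLib

/-!
# Bookkeeping tools for the estimates of the Cheskidov–Luo convex-integration step

Analysis/FluidPDE support file (all proved, [folklore]) for the proof of Prop. 4.1 of
A. Cheskidov, X. Luo, *Sharp nonuniqueness for the Navier–Stokes equations*, Invent. Math. 229
(2022) = arXiv:2009.06596, §5 (numbering of the held arXiv copy). Every field of the scheme
(`CLPerturbation`, `CLStressAlgebra`) is a finite sum over the directions `x` of the geometric
lemma of products `(time factor)(t) · (amplitude)(t,y) · (spatial block)(y)`, and every estimate
of §5 ("taking `L^p` in space and then in time", Lemma 5.2, Props. 5.3–5.5, Lemmas 5.6–5.8) is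
obtained from a POINTWISE majorant `‖F(t,y)‖ ≤ ∑ᵢ cᵢ(t) |mᵢ(y)|` by the three steps isolated here:

* `eLpNorm_le_of_norm_le_sum` — slice bound: `‖F(t)‖_{L^p(𝕋^d)} ≤ ∑ᵢ cᵢ(t) Kᵢ` if
  `‖mᵢ‖_{L^p} ≤ Kᵢ`;
* `eLqLpNorm_one_le_sum_mul_integral` / `eLqLpNorm_le_sum_mul_eLpNorm` — time integration:
  `‖F‖_{L¹(0,T;L^p)} ≤ ∑ᵢ Kᵢ ∫₀ᵀ |fᵢ|`, `‖F‖_{L^q(0,T;L^p)} ≤ ∑ᵢ Kᵢ ‖fᵢ‖_{L^q(0,T)}` when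
  `cᵢ(t) = Kᵢ |fᵢ(t)|`, and `eLpNorm_restrict_Ioo_le_of_integral_rpow_le`
  (`‖f‖_{L^q(0,T)} ≤ B^{1/q}` if `∫₀ᵀ |f|^q ≤ B`);
* `eLqLpNorm_two_two_le_of_integral_sq_le` — the energy form: `‖F‖_{L²(0,T;L²)} ≤ √A` if
  `∫ ‖F(t)‖² dy ≤ e(t)` and `∫₀ᵀ e ≤ A`; and `eLqLpNorm_one_one_eq_ofReal_integral`
  (`‖R‖_{L¹(0,T;L¹)} = ∫₀ᵀ ∫ ‖R‖` for jointly smooth `R`), the quantity against which the energy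
  of the perturbation is measured (Prop. 5.3).

Plus the coordinate Cauchy–Schwarz inequality `abs_sum_mul_apply_le` used by the majorants of the
corrector terms (`|k·v| ≤ ‖k‖‖v‖`).

## References

* A. Cheskidov, X. Luo, arXiv:2009.06596, §5.2 Lemma 5.2, Props. 5.3–5.5, §5.3 Lemmas 5.6–5.8.
  [`CheskidovLuo2022`]
-/

noncomputable section

open MeasureTheory Set Filter Topology
open scoped ENNReal NNReal

namespace Literature.Analysis.FluidPDE

namespace Torus

variable {d : Type*} [Fintype d]

/-! ## A pointwise inequality on `ℝ^d` -/

section Pointwise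

/-- Cauchy–Schwarz in coordinates: `|∑ᵢ kᵢ vᵢ| ≤ ‖k‖ ‖v‖`. [folklore] -/
theorem abs_sum_mul_apply_le (k v : EuclideanSpace ℝ d) : |∑ i, k i * v i| ≤ ‖k‖ * ‖v‖ := by
  have h : ∑ i, k i * v i = inner ℝ v k := by
    simp [PiLp.inner_apply]
  rw [h]
  calc |inner ℝ v k| ≤ ‖v‖ * ‖k‖ := abs_real_inner_le_norm v k
    _ = ‖k‖ * ‖v‖ := mul_comm _ _

end Pointwise

/-! ## Slice bounds from finite-sum majorants -/

section Slice

variable {E : Type*} [NormedAddCommGroup E] {p : ℝ≥0∞}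

/-- **Slice bound from a finite-sum majorant.** If `‖F(y)‖ ≤ ∑ᵢ cᵢ |mᵢ(y)|` with `cᵢ ≥ 0` and
`‖mᵢ‖_{L^p(𝕋^d)} ≤ Kᵢ` (`Kᵢ ≥ 0`, `p ≥ 1`), then `‖F‖_{L^p(𝕋^d)} ≤ ∑ᵢ cᵢ Kᵢ`. [folklore] -/
theorem eLpNorm_le_of_norm_le_sum {ι : Type*} (s : Finset ι) {F : UnitAddTorus d → E}
    {c K : ι → ℝ} {m : ι → UnitAddTorus d → ℝ} (hc : ∀ i ∈ s, 0 ≤ c i) (hK : ∀ i ∈ s, 0 ≤ K i)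
    (hm : ∀ i ∈ s, AEStronglyMeasurable (m i) volume)
    (hmK : ∀ i ∈ s, eLpNorm (m i) p volume ≤ ENNReal.ofReal (K i))
    (h : ∀ y, ‖F y‖ ≤ ∑ i ∈ s, c i * |m i y|) (hp : 1 ≤ p) :
    eLpNorm F p volume ≤ ENNReal.ofReal (∑ i ∈ s, c i * K i) := by
  have h1 : eLpNorm F p volume ≤ eLpNorm (∑ i ∈ s, fun y => c i * |m i y|) p volume := by
    refine eLpNorm_mono_real fun y => ?_
    rw [Finset.sum_apply]
    exact h y
  have h2 : eLpNorm (∑ i ∈ s, fun y => c i * |m i y|) p volume ≤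
      ∑ i ∈ s, eLpNorm (fun y => c i * |m i y|) p volume :=
    eLpNorm_sum_le (fun i hi => by
      have := ((hm i hi).norm).const_mul (c i)
      simpa [Real.norm_eq_abs] using this) hp
  have h3 : ∀ i ∈ s, eLpNorm (fun y => c i * |m i y|) p volume ≤ ENNReal.ofReal (c i * K i) := by
    intro i hi
    have e1 : (fun y => c i * |m i y|) = c i • fun y => ‖m i y‖ := by
      funext y; simp [Real.norm_eq_abs]
    rw [e1, eLpNorm_const_smul, eLpNorm_norm, Real.enorm_eq_ofReal (hc i hi), ENNReal.ofReal_mul (hc i hi)]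
    exact mul_le_mul' le_rfl (hmK i hi)
  calc eLpNorm F p volume ≤ ∑ i ∈ s, eLpNorm (fun y => c i * |m i y|) p volume := h1.trans h2
    _ ≤ ∑ i ∈ s, ENNReal.ofReal (c i * K i) := Finset.sum_le_sum h3
    _ = ENNReal.ofReal (∑ i ∈ s, c i * K i) :=
        (ENNReal.ofReal_sum_of_nonneg fun i hi => mul_nonneg (hc i hi) (hK i hi)).symm

omit [Fintype d] in
/-- **Sup bound from a finite-sum majorant**: if `‖F(y)‖ ≤ ∑ᵢ cᵢ |mᵢ(y)|` with `cᵢ ≥ 0` and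
`|mᵢ| ≤ Mᵢ`, then `‖F(y)‖ ≤ ∑ᵢ cᵢ Mᵢ` for every `y`, hence `‖F‖_{L^p(𝕋^d)} ≤ ∑ᵢ cᵢ Mᵢ` for every
`p` (probability space). [folklore] -/
theorem norm_le_sum_of_norm_le_sum {ι : Type*} (s : Finset ι) {F : UnitAddTorus d → E}
    {c M : ι → ℝ} {m : ι → UnitAddTorus d → ℝ} (hc : ∀ i ∈ s, 0 ≤ c i)
    (hmM : ∀ i ∈ s, ∀ y, |m i y| ≤ M i) (h : ∀ y, ‖F y‖ ≤ ∑ i ∈ s, c i * |m i y|) (y : UnitAddTorus d) :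
    ‖F y‖ ≤ ∑ i ∈ s, c i * M i :=
  (h y).trans (Finset.sum_le_sum fun i hi => mul_le_mul_of_nonneg_left (hmM i hi y) (hc i hi))

/-- `L^p` form of `norm_le_sum_of_norm_le_sum`. [folklore] -/
theorem eLpNorm_le_of_norm_le_sum_of_abs_le {ι : Type*} (s : Finset ι) {F : UnitAddTorus d → E}
    {c M : ι → ℝ} {m : ι → UnitAddTorus d → ℝ} (hc : ∀ i ∈ s, 0 ≤ c i)
    (hmM : ∀ i ∈ s, ∀ y, |m i y| ≤ M i) (h : ∀ y, ‖F y‖ ≤ ∑ i ∈ s, c i * |m i y|) (p : ℝ≥0∞) :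
    eLpNorm F p volume ≤ ENNReal.ofReal (∑ i ∈ s, c i * M i) :=
  eLpNorm_le_of_forall_norm_le (norm_le_sum_of_norm_le_sum s hc hmM h) p

end Slice

/-! ## Time integration of slice bounds -/

section Time

variable {E : Type*} [NormedAddCommGroup E] {T : ℝ} {Z : ℝ → UnitAddTorus d → E} {p q : ℝ≥0∞}

/-- **`L¹_t L^p_x` from slice bounds with separated time factors**: if
`‖Z(t)‖_{L^p} ≤ ∑ᵢ Kᵢ |fᵢ(t)|` on `(0,T)` with `Kᵢ ≥ 0` and `fᵢ` continuous on `[0,T]` (`T ≥ 0`),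
then `‖Z‖_{L¹(0,T;L^p)} ≤ ∑ᵢ Kᵢ ∫₀ᵀ |fᵢ|`. [folklore] -/
theorem eLqLpNorm_one_le_sum_mul_integral {ι : Type*} (s : Finset ι) {K : ι → ℝ} {f : ι → ℝ → ℝ}
    (hT : 0 ≤ T) (hK : ∀ i ∈ s, 0 ≤ K i) (hf : ∀ i ∈ s, ContinuousOn (f i) (Icc 0 T))
    (hle : ∀ t ∈ Ioo 0 T, eLpNorm (Z t) p volume ≤ ENNReal.ofReal (∑ i ∈ s, K i * |f i t|)) :
    eLqLpNorm 1 p Z (Ioo 0 T) ≤ ENNReal.ofReal (∑ i ∈ s, K i * ∫ t in (0 : ℝ)..T, |f i t|) := by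
  have hφc : ContinuousOn (fun t => ∑ i ∈ s, K i * |f i t|) (Icc 0 T) :=
    continuousOn_finsetSum s fun i hi => continuousOn_const.mul (hf i hi).abs
  have hφ0 : ∀ t ∈ Ioo 0 T, 0 ≤ ∑ i ∈ s, K i * |f i t| := fun t _ =>
    Finset.sum_nonneg fun i hi => mul_nonneg (hK i hi) (abs_nonneg _)
  refine (eLqLpNorm_one_le_ofReal_integral_of_slice_le hT hφc hφ0 hle).trans (le_of_eq ?_)
  congr 1
  have hint : ∀ i ∈ s, IntervalIntegrable (fun t => K i * |f i t|) volume 0 T := fun i hi =>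
    ((continuousOn_const.mul (hf i hi).abs).mono (by rw [uIcc_of_le hT])).intervalIntegrable
  rw [intervalIntegral.integral_finsetSum hint]
  exact Finset.sum_congr rfl fun i _ => intervalIntegral.integral_const_mul _ _

/-- **`L^q_t L^p_x` from slice bounds with separated time factors** (`q ≥ 1`): if
`‖Z(t)‖_{L^p} ≤ ∑ᵢ Kᵢ |fᵢ(t)|` on `(0,T)` with `Kᵢ ≥ 0` and `fᵢ` continuous on `[0,T]`, then
`‖Z‖_{L^q(0,T;L^p)} ≤ ∑ᵢ Kᵢ ‖fᵢ‖_{L^q(0,T)}`. [folklore] -/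
theorem eLqLpNorm_le_sum_mul_eLpNorm {ι : Type*} (s : Finset ι) {K : ι → ℝ} {f : ι → ℝ → ℝ}
    (hK : ∀ i ∈ s, 0 ≤ K i) (hf : ∀ i ∈ s, ContinuousOn (f i) (Icc 0 T)) (hq : 1 ≤ q)
    (hle : ∀ t ∈ Ioo 0 T, eLpNorm (Z t) p volume ≤ ENNReal.ofReal (∑ i ∈ s, K i * |f i t|)) :
    eLqLpNorm q p Z (Ioo 0 T) ≤
      ∑ i ∈ s, ENNReal.ofReal (K i) * eLpNorm (f i) q (volume.restrict (Ioo 0 T)) := by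
  have hφ0 : ∀ t ∈ Ioo 0 T, 0 ≤ ∑ i ∈ s, K i * |f i t| := fun t _ =>
    Finset.sum_nonneg fun i hi => mul_nonneg (hK i hi) (abs_nonneg _)
  refine (eLqLpNorm_le_eLpNorm_of_slice_le hφ0 hle).trans ?_
  refine (eLpNorm_sum_restrict_Ioo_le s (φ := fun i t => K i * |f i t|)
    (fun i hi => continuousOn_const.mul (hf i hi).abs) hq).trans ?_
  refine Finset.sum_le_sum fun i hi => le_of_eq ?_
  rw [eLpNorm_const_mul_restrict, abs_of_nonneg (hK i hi)]
  congr 1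
  have e : (fun t => |f i t|) = fun t => ‖f i t‖ := by funext t; rw [Real.norm_eq_abs]
  rw [e, eLpNorm_norm]

/-- `‖f‖_{L^q(0,T)} ≤ B^{1/q}` for a continuous profile with `∫₀ᵀ |f|^q ≤ B` (`q ≥ 1` real,
`T ≥ 0`). [folklore] -/
theorem eLpNorm_restrict_Ioo_le_of_integral_rpow_le {f : ℝ → ℝ} (hT : 0 ≤ T)
    (hf : ContinuousOn f (Icc 0 T)) {q : ℝ} (hq : 1 ≤ q) {B : ℝ}
    (hB : ∫ t in (0 : ℝ)..T, |f t| ^ q ≤ B) :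
    eLpNorm f (ENNReal.ofReal q) (volume.restrict (Ioo 0 T)) ≤ ENNReal.ofReal (B ^ (1 / q)) := by
  rw [eLpNorm_restrict_Ioo_eq_ofReal_rpow hT hf hq]
  have h0 : 0 ≤ ∫ t in (0 : ℝ)..T, |f t| ^ q :=
    intervalIntegral.integral_nonneg hT fun t _ => Real.rpow_nonneg (abs_nonneg _) _
  exact ENNReal.ofReal_le_ofReal (Real.rpow_le_rpow h0 hB (by positivity))

/-- A constant slice bound: `‖Z‖_{L^q(0,T;L^p)} ≤ max(1,T) C` if `‖Z(t)‖_{L^p} ≤ C` on `(0,T)`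
(`C ≥ 0`, `q ≥ 1`). [folklore] -/
theorem eLqLpNorm_le_of_slice_le_const {C : ℝ} (hC : 0 ≤ C) (hq : 1 ≤ q)
    (hle : ∀ t ∈ Ioo 0 T, eLpNorm (Z t) p volume ≤ ENNReal.ofReal C) :
    eLqLpNorm q p Z (Ioo 0 T) ≤ ENNReal.ofReal (max 1 T * C) := by
  refine (eLqLpNorm_le_eLpNorm_of_slice_le (φ := fun _ => C) (fun _ _ => hC) hle).trans ?_
  have h := eLpNorm_const_restrict_Ioo_le (T := T) C hq
  rwa [abs_of_nonneg hC] at h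

end Time

/-! ## The energy form and the `L¹_{t,x}` norm of a smooth field -/

section Energy

variable {E : Type*} [NormedAddCommGroup E] {T : ℝ} {Z : ℝ → UnitAddTorus d → E}

/-- `‖g‖_{L²(𝕋^d)} ≤ √A` for a continuous field with `∫ ‖g‖² ≤ A`. [folklore] -/
theorem eLpNorm_two_le_ofReal_sqrt {g : UnitAddTorus d → E} (hg : Continuous g) {A : ℝ}
    (hA : ∫ y, ‖g y‖ ^ 2 ≤ A) : eLpNorm g 2 volume ≤ ENNReal.ofReal (Real.sqrt A) := by
  obtain ⟨B, hB⟩ := isCompact_univ.exists_bound_of_continuousOn hg.continuousOn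
  have hmem : MemLp g 2 volume :=
    (memLp_top_of_bound hg.aestronglyMeasurable B (Eventually.of_forall fun y => hB y (mem_univ y))).mono_exponent
      le_top
  rw [hmem.eLpNorm_eq_integral_rpow_norm (by norm_num) (by norm_num)]
  refine ENNReal.ofReal_le_ofReal ?_
  have h2 : (2 : ℝ≥0∞).toReal = 2 := by norm_num
  rw [h2]
  have e : ∫ y, ‖g y‖ ^ (2 : ℝ) = ∫ y, ‖g y‖ ^ 2 :=
    integral_congr_ae (Eventually.of_forall fun y => Real.rpow_two _)
  rw [e, Real.sqrt_eq_rpow, one_div]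
  exact Real.rpow_le_rpow (integral_nonneg fun _ => sq_nonneg _) hA (by norm_num)

/-- **The energy form of the mixed norm.** If `∫ ‖Z(t,y)‖² dy ≤ e(t)` for `t ∈ (0,T)` with `Z(t)`
continuous, `e ≥ 0` continuous on `[0,T]` (`T ≥ 0`) and `∫₀ᵀ e ≤ A`, then
`‖Z‖_{L²(0,T;L²(𝕋^d))} ≤ √A`. [folklore] -/
theorem eLqLpNorm_two_two_le_of_integral_sq_le (hT : 0 ≤ T) (hZ : ∀ t ∈ Ioo 0 T, Continuous (Z t))
    {e : ℝ → ℝ} (hec : ContinuousOn e (Icc 0 T)) (he0 : ∀ t ∈ Icc 0 T, 0 ≤ e t)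
    (he : ∀ t ∈ Ioo 0 T, ∫ y, ‖Z t y‖ ^ 2 ≤ e t) {A : ℝ} (hA : ∫ t in (0 : ℝ)..T, e t ≤ A) :
    eLqLpNorm 2 2 Z (Ioo 0 T) ≤ ENNReal.ofReal (Real.sqrt A) := by
  have hslice : ∀ t ∈ Ioo 0 T, eLpNorm (Z t) 2 volume ≤ ENNReal.ofReal (Real.sqrt (e t)) :=
    fun t ht => eLpNorm_two_le_ofReal_sqrt (hZ t ht) (he t ht)
  refine (eLqLpNorm_le_eLpNorm_of_slice_le (φ := fun t => Real.sqrt (e t))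
    (fun t _ => Real.sqrt_nonneg _) hslice).trans ?_
  have hsc : ContinuousOn (fun t => Real.sqrt (e t)) (Icc 0 T) := hec.sqrt
  have h2 : (2 : ℝ≥0∞) = ENNReal.ofReal 2 := by norm_num
  rw [h2, eLpNorm_restrict_Ioo_eq_ofReal_rpow hT hsc (by norm_num : (1 : ℝ) ≤ 2)]
  refine ENNReal.ofReal_le_ofReal ?_
  have hint : ∫ t in (0 : ℝ)..T, |Real.sqrt (e t)| ^ (2 : ℝ) = ∫ t in (0 : ℝ)..T, e t := by
    refine intervalIntegral.integral_congr fun t ht => ?_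
    rw [uIcc_of_le hT] at ht
    rw [abs_of_nonneg (Real.sqrt_nonneg _), Real.rpow_two, Real.sq_sqrt (he0 t ht)]
  rw [hint]
  have hA0 : 0 ≤ ∫ t in (0 : ℝ)..T, e t := intervalIntegral.integral_nonneg hT he0
  rw [Real.sqrt_eq_rpow]
  exact Real.rpow_le_rpow hA0 hA (by norm_num)

/-- **`‖R‖_{L¹(0,T;L¹(𝕋^d))} = ∫₀ᵀ ∫ ‖R(t,y)‖ dy dt`** for a field jointly smooth on `[0,T] × 𝕋^d`
(`T ≥ 0`). [folklore] -/
theorem eLqLpNorm_one_one_eq_ofReal_integral {F : Type*} [NormedAddCommGroup F] [NormedSpace ℝ F]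
    {R : ℝ → UnitAddTorus d → F} (hR : FunctionSpaces.Torus.IsSmoothSpaceTimeOn (Icc 0 T) R) (hT : 0 ≤ T) :
    eLqLpNorm 1 1 R (Ioo 0 T) = ENNReal.ofReal (∫ t in (0 : ℝ)..T, ∫ y, ‖R t y‖) := by
  -- the slice norms as real integrals
  have hsl : ∀ t ∈ Icc 0 T, (eLpNorm (R t) 1 volume).toReal = ∫ y, ‖R t y‖ := by
    intro t ht
    rw [eLpNorm_one_eq_lintegral_enorm, integral_norm_eq_lintegral_enorm (hR.isSmooth_slice ht).continuous.aestronglyMeasurable]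
  have hcont : ContinuousOn (fun t => (eLpNorm (R t) 1 volume).toReal) (Icc 0 T) :=
    hR.continuousOn_eLpNorm_toReal le_rfl
  have hcont' : ContinuousOn (fun t => ∫ y, ‖R t y‖) (Icc 0 T) :=
    hcont.congr fun t ht => (hsl t ht).symm
  have h0 : ∀ t ∈ Ioo 0 T, 0 ≤ ∫ y, ‖R t y‖ := fun t _ => integral_nonneg fun _ => norm_nonneg _
  rw [eLqLpNorm, FluidPDE.eLqLpNorm, eLpNorm_one_eq_lintegral_enorm, intervalIntegral.integral_of_le hT,
    integral_Ioc_eq_integral_Ioo]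
  have hint : IntegrableOn (fun t => ∫ y, ‖R t y‖) (Ioo 0 T) volume :=
    (hcont'.integrableOn_compact isCompact_Icc).mono_set Ioo_subset_Icc_self
  rw [ofReal_integral_eq_lintegral_ofReal hint (ae_restrict_of_forall_mem measurableSet_Ioo h0)]
  refine setLIntegral_congr_fun measurableSet_Ioo fun t ht => ?_
  rw [Real.enorm_eq_ofReal ENNReal.toReal_nonneg, hsl t (Ioo_subset_Icc_self ht)]

end Energy

end Torus

end Literature.Analysis.FluidPDE
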